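import Literature.Analysis.FluidPDE.AxisymBiotSavartSupBound
import Literature.Analysis.FluidPDE.BiotSavartRepresentationSqIntegrable
import HarnessLib

/-!
# Gallay–Šverák 2015, (5.12) along swirl-free axisymmetric flows, and the reduction of the
# velocity decay (1.12) to the vorticity bound (1.11):
# `GallaySverak2015.VorticitySupBound → GallaySverak2015.VelocitySupDecay`

Analysis/FluidPDE proof file (theorems only; no definitions, no named facts; net debt `0` — it makes
the named fact `GallaySverak2015.VelocitySupDecay` ((1.12) of Th. Gallay, V. Šverák, *Remarks on the
Cauchy problem for the axisymmetric Navier–Stokes equations*, Confluentes Math. 7 (2015) 67–92 =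
arXiv:1510.01036, `AxisymNoSwirlScaleInvariantBounds.lean`) a CONSEQUENCE of the named fact
`GallaySverak2015.VorticitySupBound` (Prop. 5.3 `p = ∞` = (1.11), same file), exactly as in print
(p. 17, proof of Prop. 5.5): "using Proposition 2.3, Lemma 5.1, and Proposition 5.3, we easily
obtain (5.12) `‖u(t₀)‖_{L^∞(Ω)} ≤ C‖ω_θ(t₀)‖_{L¹(Ω)}^{1/2}‖ω_θ(t₀)‖_{L^∞(Ω)}^{1/2} ≤ C(M)/√t₀`".

* `IsTaoSolutionOn.norm_le_sqrt_of_norm_curl_le` — **(5.12), kinematic + Lemma 5.1, along the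
  flow**: for a Tao-class solution `(u, p)` on `[0, T]` (`0 < T`, any `ν > 0`) from an axisymmetric
  swirl-free datum `u₀` with `η₀ = ω_θ/r = angVortQuot u₀ ∈ L¹(ℝ³)`, every `t ∈ [0, T]` and every
  bound `‖ω(t, ·)‖ ≤ L`: `‖u(t, x)‖ ≤ (11/10) √(L ∫|η₀|)` for all `x`. Ingredients, all tree theorems:
  the slice is axisymmetric without swirl (`IsTaoSolutionOn.isAxisymmetric`, `…hasNoSwirl`), its
  vorticity satisfies `‖ω‖/r ≤ |η(t)|` (`‖ω‖ = r|η|`, `norm_curl_eq_cylRadius_mul_abs_angVortQuot`),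
  `∫|η(t)| ≤ ∫|η₀|` (Lemma 5.1, `lintegral_abs_angVortQuot_le_of_datum`), the slice IS the
  Biot–Savart velocity of its vorticity WITHOUT any integrability proviso
  (`IsTaoSolutionOn.biotSavart_curl_eq_self`, `BiotSavartRepresentationSqIntegrable.lean` — the step
  that was missing, cf. the module docstring of `AxisymBiotSavartSupBound.lean`, "What is NOT
  here"), and the sup-norm form (2.10) of the axisymmetric Biot–Savart bound with its explicit
  constant, `norm_biotSavart_le_sqrt_of_isAxisymmetric_of_norm_le`
  (`‖K₃ ∗ w‖ ≤ (11/10)√(L ∫‖w‖/r)`).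
* `GallaySverak2015.velocitySupDecay_of_vorticitySupBound` — **(1.12) ⇐ (1.11)**: if
  `t‖ω(t, x)‖ ≤ C(M)` (`M = ‖ω₀‖_{L¹(Ω)} = (2π)⁻¹∫|η₀|`) then `√t ‖u(t, x)‖ ≤ C′(M)` with
  `C′(s) = (11/10) √(2π s · C(s))`, and `C′(s) = O(s)` as `s → 0` because `C(s) = O(s)`
  (`C′(s) ≤ (11/10)√(2π|K|) s` on `[0, δ]` if `C(s) ≤ Ks` there). With it the debt behind (1.12) is
  exactly the debt behind (1.11) (Prop. 5.3, a theory-sized item: §3 semigroup + §4 iteration +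
  Feng–Šverák's Lemma 5.2), not an independent one.

## Mathlib / tree search

`lean search 'velocitySupDecay_of|VelocitySupDecay_holds'` (2026-08-27): nothing — the reduction was
recorded as wanted in `AxisymBiotSavartSupBound.lean` (module docstring) and in the cell's harvest
map (row C27) but never landed. Tree (used): `GallaySverak2015.VorticitySupBound`,
`GallaySverak2015.VelocitySupDecay`, `norm_curl_eq_cylRadius_mul_abs_angVortQuot`
(`AxisymNoSwirlScaleInvariantBounds`); `norm_biotSavart_le_sqrt_of_isAxisymmetric_of_norm_le`
(`AxisymBiotSavartSupBound`); `IsTaoSolutionOn.biotSavart_curl_eq_self`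
(`BiotSavartRepresentationSqIntegrable`); `IsTaoSolutionOn.isAxisymmetric`, `…hasNoSwirl`
(`AxisymmetricNoSwirlGlobal`); `IsTaoSolutionOn.lintegral_abs_angVortQuot_le_of_datum`
(`AxisymNoSwirlCoSignedFlux`); `contDiff_angVortQuot`, `continuous_cylRadius`, `cylRadius_nonneg`,
`IsAxisymmetric.curl`.

## References

* Th. Gallay, V. Šverák, *Remarks on the Cauchy problem for the axisymmetric Navier–Stokes
  equations*, Confluentes Math. 7 (2015) 67–92 = arXiv:1510.01036: (1.11)–(1.12) (p. 4),
  Prop. 2.3 (ii) (2.10) (p. 7), Lemma 5.1 (p. 16), Prop. 5.3 (p. 16–17), (5.12) (p. 17).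
  [GallaySverak2016]
-/

noncomputable section

open MeasureTheory Set Function Filter
open _root_.Topology
open scoped ENNReal NNReal

namespace Literature.Analysis.FluidPDE

variable {T ν : ℝ} {u₀ : EuclideanSpace ℝ (Fin 3) → EuclideanSpace ℝ (Fin 3)}
  {u : ℝ → EuclideanSpace ℝ (Fin 3) → EuclideanSpace ℝ (Fin 3)}
  {p : ℝ → EuclideanSpace ℝ (Fin 3) → ℝ}

/-- **Gallay–Šverák 2015, (5.12) along the flow (kinematic half + Lemma 5.1).** Let `(u, p)` be a
Tao-class solution on `[0, T]` (`0 < T`, `ν > 0`) of the unforced Navier–Stokes system from an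
axisymmetric swirl-free datum `u₀` with `η₀ = angVortQuot u₀ = ω_θ/r ∈ L¹(ℝ³)`
(`ω₀ ∈ L¹(Ω)`), let `t ∈ [0, T]`, and suppose `‖curl (u t) y‖ ≤ L` for all `y`. Then for all `x`,
`‖u(t, x)‖ ≤ (11/10) √(L · ∫|η₀|)`; in the paper's units
(`∫|η₀| dx = 2π‖ω₀‖_{L¹(Ω)}`, `L = ‖ω_θ(t)‖_{L^∞}`):
`‖u(t)‖_∞ ≤ (11/10)√(2π) ‖ω₀‖_{L¹(Ω)}^{1/2} ‖ω_θ(t)‖_{L^∞}^{1/2}`, which is (5.12)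
"`‖u(t₀)‖_{L^∞} ≤ C‖ω_θ(t₀)‖_{L¹(Ω)}^{1/2}‖ω_θ(t₀)‖_{L^∞(Ω)}^{1/2}`" combined with Lemma 5.1
`‖ω_θ(t₀)‖_{L¹(Ω)} ≤ ‖ω₀‖_{L¹(Ω)}`. Proof: the slice is axisymmetric without swirl, is the Biot–Savart
velocity of its vorticity (`IsTaoSolutionOn.biotSavart_curl_eq_self`, no integrability proviso),
`‖ω(t)‖/r ≤ |η(t)|` pointwise (`‖ω‖ = r|η|`) with `∫|η(t)| ≤ ∫|η₀|`, and (2.10) in the form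
`norm_biotSavart_le_sqrt_of_isAxisymmetric_of_norm_le`.
[cite: GallaySverak2016, (5.12) (arXiv p. 17) with Prop. 2.3 (ii) (2.10) (p. 7) and Lemma 5.1 (p. 16)] -/
theorem IsTaoSolutionOn.norm_le_sqrt_of_norm_curl_le (h : IsTaoSolutionOn T ν u₀ u p) (hT : 0 < T)
    (hν : 0 < ν) (h0 : IsAxisymmetric u₀) (h0' : HasNoSwirl u₀) (hL1 : Integrable (angVortQuot u₀))
    {t : ℝ} (ht : t ∈ Icc 0 T) {L : ℝ} (hL : ∀ y, ‖curl (u t) y‖ ≤ L) (x : EuclideanSpace ℝ (Fin 3)) :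
    ‖u t x‖ ≤ 11 / 10 * Real.sqrt (L * ∫ y, |angVortQuot u₀ y|) := by
  have h0T : (0 : ℝ) ∈ Icc 0 T := ⟨le_rfl, hT.le⟩
  have hL0 : 0 ≤ L := (norm_nonneg _).trans (hL 0)
  -- the slice at time `t`
  have hax : IsAxisymmetric (u t) := h.isAxisymmetric hν hT h0 t ht
  have hsw : HasNoSwirl (u t) := h.hasNoSwirl hν hT h0 h0' t ht
  have hu3 : ContDiff ℝ 3 (u t) := (h.classical.contDiff_velocity ht).of_le (by norm_cast)
  have hu1 : ContDiff ℝ 1 (u t) := hu3.of_le (by norm_cast)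
  have hωc : Continuous (curl (u t)) := continuous_curl hu1
  have hηc : Continuous (angVortQuot (u t)) :=
    (contDiff_angVortQuot (n := 0) (by exact_mod_cast hu3)).continuous
  have hωeq : ∀ y, ‖curl (u t) y‖ = cylRadius y * |angVortQuot (u t) y| :=
    norm_curl_eq_cylRadius_mul_abs_angVortQuot hax hsw hu3
  -- `η(t) ∈ L¹` with `∫|η(t)| ≤ ∫|η₀|` (Lemma 5.1, tree)
  have hlin : ∫⁻ y, ‖angVortQuot (u t) y‖ₑ ≤ ∫⁻ y, ‖angVortQuot u₀ y‖ₑ := by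
    have := h.lintegral_abs_angVortQuot_le_of_datum hT hν h0 h0' h0T ht ht.1
    rwa [h.initial] at this
  have hηint : Integrable (angVortQuot (u t)) :=
    ⟨hηc.aestronglyMeasurable, lt_of_le_of_lt hlin hL1.hasFiniteIntegral⟩
  have hA : ∫ y, |angVortQuot (u t) y| ≤ ∫ y, |angVortQuot u₀ y| := by
    have e1 : ∫ y, |angVortQuot (u t) y| = (∫⁻ y, ‖angVortQuot (u t) y‖ₑ).toReal := by
      rw [← integral_norm_eq_lintegral_enorm hηc.aestronglyMeasurable]
      simp only [Real.norm_eq_abs]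
    have e2 : ∫ y, |angVortQuot u₀ y| = (∫⁻ y, ‖angVortQuot u₀ y‖ₑ).toReal := by
      rw [← integral_norm_eq_lintegral_enorm hL1.aestronglyMeasurable]
      simp only [Real.norm_eq_abs]
    rw [e1, e2]
    exact ENNReal.toReal_mono hL1.hasFiniteIntegral.ne hlin
  -- `‖ω(t)‖/r ≤ |η(t)|` pointwise (equality off the axis; `0` on the axis, where `x/0 = 0`)
  have hquot_le : ∀ y, ‖curl (u t) y‖ / cylRadius y ≤ |angVortQuot (u t) y| := by
    intro y
    rw [hωeq y]
    rcases (cylRadius_nonneg y).eq_or_lt with hr | hr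
    · rw [← hr, zero_mul, zero_div]; exact abs_nonneg _
    · exact le_of_eq (mul_div_cancel_left₀ _ hr.ne')
  have hquot_nn : ∀ y, 0 ≤ ‖curl (u t) y‖ / cylRadius y := fun y =>
    div_nonneg (norm_nonneg _) (cylRadius_nonneg y)
  have hquot_int : Integrable fun y => ‖curl (u t) y‖ / cylRadius y := by
    refine hηint.abs.mono' ?_ (Eventually.of_forall fun y => ?_)
    · exact (hωc.norm.measurable.div continuous_cylRadius.measurable).aestronglyMeasurable
    · rw [Real.norm_of_nonneg (hquot_nn y)]
      exact hquot_le y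
  have hB : ∫ y, ‖curl (u t) y‖ / cylRadius y ≤ ∫ y, |angVortQuot u₀ y| :=
    (integral_mono hquot_int hηint.abs hquot_le).trans hA
  -- (2.10) for `ω(t)`, and `u(t) = biotSavart ω(t)` (no integrability proviso)
  have hBS := norm_biotSavart_le_sqrt_of_isAxisymmetric_of_norm_le hωc
    (hax.curl (hu1.differentiable (by simp))) hL hquot_int x
  rw [h.biotSavart_curl_eq_self ht] at hBS
  refine hBS.trans (mul_le_mul_of_nonneg_left (Real.sqrt_le_sqrt ?_) (by norm_num))
  exact mul_le_mul_of_nonneg_left hB hL0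

/-- **Gallay–Šverák 2015: the velocity decay (1.12) follows from the vorticity bound (1.11)** — the
named fact `GallaySverak2015.VelocitySupDecay` is a consequence of the named fact
`GallaySverak2015.VorticitySupBound` (both `AxisymNoSwirlScaleInvariantBounds.lean`), as in print
(p. 17: "using Proposition 2.3, Lemma 5.1, and Proposition 5.3, we easily obtain (5.12)
`‖u(t₀)‖_{L^∞(Ω)} ≤ C‖ω_θ(t₀)‖_{L¹(Ω)}^{1/2}‖ω_θ(t₀)‖_{L^∞(Ω)}^{1/2} ≤ C(M) t₀^{-1/2}`"). If
`t‖ω(t, x)‖ ≤ C(M)` for `t ∈ (0, T]` with `M = ‖ω₀‖_{L¹(Ω)} = (2π)⁻¹∫|η₀|` and `C(s) = O(s)`, then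
`√t ‖u(t, x)‖ ≤ C′(M)` with `C′(s) = (11/10)√(2π s · C(s))`, again `O(s)` as `s → 0`
(`IsTaoSolutionOn.norm_le_sqrt_of_norm_curl_le` with `L = C(M)/t`, and
`√t · √((C(M)/t) · 2πM) = √(2πM · C(M))`).
[cite: GallaySverak2016, (1.12) (arXiv p. 4) and (5.12) in the proof of Prop. 5.5 (p. 17)] -/
theorem GallaySverak2015.velocitySupDecay_of_vorticitySupBound
    (hV : GallaySverak2015.VorticitySupBound) : GallaySverak2015.VelocitySupDecay := by
  obtain ⟨C, ⟨K, δ, hδ, hK⟩, hC⟩ := hV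
  refine ⟨fun s => 11 / 10 * Real.sqrt (2 * Real.pi * s * C s),
    ⟨11 / 10 * Real.sqrt (2 * Real.pi * |K|), δ, hδ, fun s hs0 hsδ => ?_⟩, ?_⟩
  · -- `C′(s) = O(s)`: `2π s C(s) ≤ 2π |K| s²` on `[0, δ]`
    have h1 : 2 * Real.pi * s * C s ≤ 2 * Real.pi * |K| * s ^ 2 := by
      have hCs : C s ≤ |K| * s := (hK s hs0 hsδ).trans
        (mul_le_mul_of_nonneg_right (le_abs_self K) hs0)
      have h2π : 0 ≤ 2 * Real.pi * s := by positivity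
      nlinarith [mul_le_mul_of_nonneg_left hCs h2π]
    rw [mul_assoc (11 / 10 : ℝ) (Real.sqrt (2 * Real.pi * |K|)) s]
    refine mul_le_mul_of_nonneg_left ?_ (by norm_num)
    calc Real.sqrt (2 * Real.pi * s * C s) ≤ Real.sqrt (2 * Real.pi * |K| * s ^ 2) :=
          Real.sqrt_le_sqrt h1
      _ = Real.sqrt (2 * Real.pi * |K|) * s := by
          rw [Real.sqrt_mul (by positivity), Real.sqrt_sq hs0]
  · intro T u₀ u p hT h h0 h0' hL1 t ht x
    set M : ℝ := (2 * Real.pi)⁻¹ * ∫ y, |angVortQuot u₀ y| with hM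
    have ht0 : 0 < t := ht.1
    have htI : t ∈ Icc 0 T := ⟨ht.1.le, ht.2⟩
    -- `‖ω(t, y)‖ ≤ C(M)/t`
    have hL : ∀ y, ‖curl (u t) y‖ ≤ C M / t := fun y => by
      rw [le_div_iff₀ ht0, mul_comm]
      exact hC hT h h0 h0' hL1 t ht y
    have hCM : 0 ≤ C M := by
      have := hL 0
      have h0' : 0 ≤ C M / t := (norm_nonneg _).trans this
      exact (div_nonneg_iff.1 h0').elim (fun h => h.1) fun h => absurd h.2 (not_le.2 ht0)
    -- (5.12) along the flow with `L = C(M)/t`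
    have hkey := h.norm_le_sqrt_of_norm_curl_le hT one_pos h0 h0' hL1 htI hL x
    have hI : ∫ y, |angVortQuot u₀ y| = 2 * Real.pi * M := by
      rw [hM, ← mul_assoc, mul_inv_cancel₀ (by positivity : (2 : ℝ) * Real.pi ≠ 0), one_mul]
    rw [hI] at hkey
    -- `√t · (11/10) √((C M / t) (2π M)) = (11/10) √(2π M · C M)`
    have hsq : Real.sqrt t * Real.sqrt (C M / t * (2 * Real.pi * M)) =
        Real.sqrt (2 * Real.pi * M * C M) := by
      rw [← Real.sqrt_mul ht0.le]
      congr 1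
      field_simp
    calc Real.sqrt t * ‖u t x‖ ≤ Real.sqrt t * (11 / 10 * Real.sqrt (C M / t * (2 * Real.pi * M))) :=
          mul_le_mul_of_nonneg_left hkey (Real.sqrt_nonneg t)
      _ = 11 / 10 * (Real.sqrt t * Real.sqrt (C M / t * (2 * Real.pi * M))) := by ring
      _ = 11 / 10 * Real.sqrt (2 * Real.pi * M * C M) := by rw [hsq]

/-- **(1.12) unpacked, from (1.11)**: assuming the fact `VorticitySupBound` only, along a Tao-class
solution (`ν = 1`) from an axisymmetric swirl-free datum with `ω₀ ∈ L¹(Ω)` the speed obeys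
`‖u(t, x)‖ ≤ C′(‖ω₀‖_{L¹(Ω)})/√t` for `0 < t ≤ T`, `C′(s) = O(s)`
(`IsTaoSolutionOn.norm_le_div_sqrt_of_fact` fed with `velocitySupDecay_of_vorticitySupBound`).
[cite: GallaySverak2016, (1.12) (arXiv p. 4) and (5.12) (p. 17)] -/
theorem IsTaoSolutionOn.norm_le_div_sqrt_of_vorticitySupBound
    (hV : GallaySverak2015.VorticitySupBound) (h : IsTaoSolutionOn T 1 u₀ u p) (hT : 0 < T)
    (h0 : IsAxisymmetric u₀) (h0' : HasNoSwirl u₀) (hL1 : Integrable (angVortQuot u₀)) :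
    ∃ C : ℝ → ℝ, (∃ K δ : ℝ, 0 < δ ∧ ∀ s, 0 ≤ s → s ≤ δ → C s ≤ K * s) ∧
      ∀ t ∈ Ioc 0 T, ∀ x,
        ‖u t x‖ ≤ C ((2 * Real.pi)⁻¹ * ∫ y, |angVortQuot u₀ y|) / Real.sqrt t :=
  h.norm_le_div_sqrt_of_fact (GallaySverak2015.velocitySupDecay_of_vorticitySupBound hV) hT h0 h0'
    hL1

end Literature.Analysis.FluidPDE

end
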